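import Summits.ValiantsHypothesis.ValiantsHypothesis.Theorems.FreeSubtorusOrbitDimensionBoundStubPerSummandPrelimB
import Literature.Computability.AlgebraicComplexity.BlockDecomposable

/-!
# `OrbitDimensionBound` (stmt-ValiantsHypothesis-16133), rung line `square_covering` — stub `stub_diagonalLifts`,
# part 1: a STABLE (block-indecomposable) pencil is Schurian, and its exact lifts are unique up to scalars

Helper file for stub 2 `stub_diagonalLifts` of `Cruxes/OrbitDimensionBound/Lines/square_covering.lean` (route
`FreeSubtorus`, rung `Power.SquareShadow`).  The stub's docstring reads "a block-indecomposable pencil with non-zero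
determinant is `θ`-stable for the Kronecker quiver, hence Schurian (`End = ℂ`): exact lifts are UNIQUE up to scalars,
…, after ONE constant base change all lifts are DIAGONAL".  This file proves the FIRST HALF:

* `det_eq_zero_of_zero_block` — the easy half of Frobenius–König: an `m × m` matrix with a zero block on rows
  `{i ≥ b}` and columns `{j < a}`, `b < a`, is singular;
* `exists_adaptedBasis` — a basis of `ℂ^m` indexed by `Fin m` whose first `dim W` vectors span the subspace `W` and in
  which the coordinates `≥ dim W` of every vector of `W` vanish;
* `exists_block_of_subpencil` — a SUB-PENCIL `(V, W)` of a square polynomial matrix `M` (every coefficient matrix maps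
  `V` into `W`) yields constant `P, Q ∈ GL_m` with `(P M Q) i j = 0` for `i ≥ dim W`, `j < dim V`;
* **`endPair_eq_smul_one_of_not_isBlockDecomposable`** — if `det M ≠ 0` and `M` is NOT block-decomposable
  (tree notion `IsBlockDecomposable`: no proper equal-size block triangularisation by constants), every endomorphism
  pair `g M = M h` is a scalar pair `g = c · 1 = h` (kernel and image sub-pencils of `(g − λ, h − λ)`; King's
  `θ`-stability ⇒ Schur);
* **`lift_eq_smul_of_not_isBlockDecomposable`** — two exact constant lifts `(G, H)`, `(G', H')` of the same matrix
  (`G M H⁻¹ = G' M H'⁻¹`) differ by one scalar.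

NOT here (the open remainder of the stub, stated honestly): that the resulting PROJECTIVE representation `γ ↦ (g_γ, h_γ)` of
the torus `T_Λ` consists of commuting semisimple pairs which diagonalise simultaneously over an admissible `Λ'` of the
same rank (identity component / saturation of `Λ`; needs the structure theory of diagonalisable groups).

Helper mode (`--supports stmt-ValiantsHypothesis-16133 --as helper`).  Honest framing: [folklore] linear algebra toward
ONE registered stub of a dormant rung line whose core `stub_gradedPowerCount` is OPEN; `OrbitDimensionBound`,
`FreeSubtorus` and VP ≠ VNP are OPEN and not moved.

## References
* A. D. King, *Moduli of representations of finite-dimensional algebras*, Quart. J. Math. 45 (1994), Prop. 3.1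
  (θ-stable ⇒ simple in the abelian category of semistables ⇒ Schur) — orientation only.
* [LandsbergRessayre2017] J. M. Landsberg, N. Ressayre, Differential Geom. Appl. 55 (2017), §1, §3.3.
-/

set_option linter.dupNamespace false

namespace Summit.ValiantsHypothesis.ValiantsHypothesis.Theorems.FreeSubtorusOrbitDimensionBound.SquareCovering

open Matrix MvPolynomial Finset Module.End
open Literature.Computability.AlgebraicComplexity
open Summit.ValiantsHypothesis.ValiantsHypothesis.Theorems.FreeSubtorusConfusionCovering
open Summit.ValiantsHypothesis.ValiantsHypothesis.Theorems.FreeSubtorusOrbitDimensionBound.SignCovering.PerSummand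

/-! ### §1 Frobenius–König, easy half -/

section FK

variable {R : Type*} [CommRing R]

/-- A square matrix with a zero block on the rows `{i | b ≤ i}` and the columns `{j | j < a}` with `b < a ≤ m` is
singular: every permutation sends some column `< a` to a row `≥ b`. [folklore] -/
theorem det_eq_zero_of_zero_block {m : ℕ} (M : Matrix (Fin m) (Fin m) R) (a b : ℕ) (ha : a ≤ m) (hba : b < a)
    (hM : ∀ i j : Fin m, b ≤ (i : ℕ) → (j : ℕ) < a → M i j = 0) : M.det = 0 := by
  classical
  rw [Matrix.det_apply']
  refine Finset.sum_eq_zero fun τ _ => ?_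
  suffices h : ∏ i, M (τ i) i = 0 by rw [h, mul_zero]
  by_contra hprod
  have hall : ∀ j : Fin m, (j : ℕ) < a → ((τ j : Fin m) : ℕ) < b := by
    intro j hj
    by_contra hbj
    exact hprod (Finset.prod_eq_zero (Finset.mem_univ j) (hM _ _ (not_lt.1 hbj) hj))
  -- `τ` maps the `a` columns `< a` injectively into the `b` rows `< b`
  let f : Fin a → Fin b := fun k => ⟨((τ ⟨k, lt_of_lt_of_le k.2 ha⟩ : Fin m) : ℕ), hall _ k.2⟩
  have hf : Function.Injective f := by
    intro k l hkl
    have h1 : ((τ ⟨k, lt_of_lt_of_le k.2 ha⟩ : Fin m) : ℕ) = ((τ ⟨l, lt_of_lt_of_le l.2 ha⟩ : Fin m) : ℕ) := by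
      have := Fin.ext_iff.1 hkl
      exact this
    have h2 := τ.injective (Fin.ext h1)
    exact Fin.ext (by simpa using congrArg Fin.val h2)
  have := Fintype.card_le_of_injective f hf
  simp only [Fintype.card_fin] at this
  omega

end FK

/-! ### §2 Bases adapted to a subspace -/

section Adapted

/-- **Adapted basis.**  For a subspace `W ≤ ℂ^m` there is a basis `b` of `ℂ^m` indexed by `Fin m` with `b i ∈ W` for
`i < dim W` and such that every vector of `W` has vanishing `b`-coordinates at the indices `≥ dim W` (a basis of `W`
followed by a basis of a complement). [folklore] -/
theorem exists_adaptedBasis (m : ℕ) (W : Submodule ℂ (Fin m → ℂ)) :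
    ∃ b : Module.Basis (Fin m) ℂ (Fin m → ℂ),
      (∀ i : Fin m, (i : ℕ) < Module.finrank ℂ W → b i ∈ W) ∧
      (∀ x ∈ W, ∀ i : Fin m, Module.finrank ℂ W ≤ (i : ℕ) → b.repr x i = 0) := by
  classical
  obtain ⟨W', hc⟩ := W.exists_isCompl
  set d₁ := Module.finrank ℂ W with hd₁
  set d₂ := Module.finrank ℂ W' with hd₂
  have hsum : d₁ + d₂ = m := by
    rw [hd₁, hd₂, Submodule.finrank_add_eq_of_isCompl hc, Module.finrank_fin_fun]
  let b₁ : Module.Basis (Fin d₁) ℂ W := Module.finBasis ℂ W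
  let b₂ : Module.Basis (Fin d₂) ℂ W' := Module.finBasis ℂ W'
  let φ : (W × W') ≃ₗ[ℂ] (Fin m → ℂ) := Submodule.prodEquivOfIsCompl W W' hc
  let e : Fin d₁ ⊕ Fin d₂ ≃ Fin m := finSumFinEquiv.trans (finCongr hsum)
  let b : Module.Basis (Fin m) ℂ (Fin m → ℂ) := ((b₁.prod b₂).map φ).reindex e
  have hinl : ∀ i : Fin m, (i : ℕ) < d₁ → ∃ k : Fin d₁, e.symm i = Sum.inl k := by
    intro i hi
    refine ⟨⟨i, hi⟩, ?_⟩
    rw [Equiv.symm_apply_eq]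
    ext
    simp [e]
  have hinr : ∀ i : Fin m, d₁ ≤ (i : ℕ) → ∃ k : Fin d₂, e.symm i = Sum.inr k := by
    intro i hi
    have hi2 : (i : ℕ) - d₁ < d₂ := by omega
    refine ⟨⟨i - d₁, hi2⟩, ?_⟩
    rw [Equiv.symm_apply_eq]
    ext
    simp [e]
    omega
  refine ⟨b, fun i hi => ?_, fun x hx i hi => ?_⟩
  · obtain ⟨k, hk⟩ := hinl i hi
    have : b i = φ ((b₁.prod b₂) (Sum.inl k)) := by
      simp only [b, Module.Basis.reindex_apply, Module.Basis.map_apply, hk]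
    rw [this, Module.Basis.prod_apply, Submodule.coe_prodEquivOfIsCompl']
    simp
  · obtain ⟨k, hk⟩ := hinr i hi
    have hx' : φ.symm x = (⟨x, hx⟩, 0) := Submodule.prodEquivOfIsCompl_symm_apply_left W W' hc ⟨x, hx⟩
    simp only [b, Module.Basis.repr_reindex_apply, hk, Module.Basis.map_repr, LinearEquiv.trans_apply, hx',
      Module.Basis.prod_repr_inr, map_zero, Finsupp.zero_apply]

end Adapted

/-! ### §3 A sub-pencil gives a block of zeros after a constant base change -/

section Block

variable {σ : Type*}

/-- **Sub-pencil ⇒ zero block.**  If every coefficient matrix of the square polynomial matrix `M` maps the subspace `V`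
into the subspace `W`, then for suitable `P, Q ∈ GL_m(ℂ)` the entries of `P M Q` in rows `≥ dim W` and columns `< dim V`
vanish. [folklore] -/
theorem exists_block_of_subpencil {m : ℕ} (M : Matrix (Fin m) (Fin m) (MvPolynomial σ ℂ))
    (V W : Submodule ℂ (Fin m → ℂ))
    (hVW : ∀ (d : σ →₀ ℕ) (x : Fin m → ℂ), x ∈ V → Matrix.toLin' (M.map (coeff d)) x ∈ W) :
    ∃ P Q : GL (Fin m) ℂ, ∀ i j : Fin m, Module.finrank ℂ W ≤ (i : ℕ) → (j : ℕ) < Module.finrank ℂ V →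
      ((P : Matrix (Fin m) (Fin m) ℂ).map C * M * (Q : Matrix (Fin m) (Fin m) ℂ).map C :
        Matrix (Fin m) (Fin m) (MvPolynomial σ ℂ)) i j = 0 := by
  classical
  obtain ⟨bR, hbRmem, hbR⟩ := exists_adaptedBasis m W
  obtain ⟨bC, hbCmem, hbC⟩ := exists_adaptedBasis m V
  set std := Pi.basisFun ℂ (Fin m) with hstd
  have hPinv : bR.toMatrix std * std.toMatrix bR = 1 := Module.Basis.toMatrix_mul_toMatrix_flip bR std
  have hPdet : (bR.toMatrix std).det ≠ 0 := by
    have h2 := congrArg Matrix.det hPinv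
    rw [Matrix.det_mul, Matrix.det_one] at h2
    exact left_ne_zero_of_mul_eq_one h2
  have hQinv : std.toMatrix bC * bC.toMatrix std = 1 := Module.Basis.toMatrix_mul_toMatrix_flip std bC
  have hQdet : (std.toMatrix bC).det ≠ 0 := by
    have h2 := congrArg Matrix.det hQinv
    rw [Matrix.det_mul, Matrix.det_one] at h2
    exact left_ne_zero_of_mul_eq_one h2
  refine ⟨Matrix.GeneralLinearGroup.mkOfDetNeZero _ hPdet, Matrix.GeneralLinearGroup.mkOfDetNeZero _ hQdet,
    fun i j hi hj => ?_⟩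
  rw [Matrix.GeneralLinearGroup.val_mkOfDetNeZero, Matrix.GeneralLinearGroup.val_mkOfDetNeZero]
  refine apply_eq_zero_of_forall_map_coeff _ i j fun d => ?_
  rw [map_coeff_mul_map_C, map_coeff_map_C_mul, toMatrix_mul_mul_toMatrix_apply]
  exact hbR _ (hVW d _ (hbCmem j hj)) i hi

/-- If moreover `dim W < dim V` then `det M = 0` (Frobenius–König). [folklore] -/
theorem det_eq_zero_of_subpencil {m : ℕ} (M : Matrix (Fin m) (Fin m) (MvPolynomial σ ℂ))
    (V W : Submodule ℂ (Fin m → ℂ))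
    (hVW : ∀ (d : σ →₀ ℕ) (x : Fin m → ℂ), x ∈ V → Matrix.toLin' (M.map (coeff d)) x ∈ W)
    (hlt : Module.finrank ℂ W < Module.finrank ℂ V) : M.det = 0 := by
  obtain ⟨P, Q, hPQ⟩ := exists_block_of_subpencil M V W hVW
  have hV : Module.finrank ℂ V ≤ m := by
    simpa [Module.finrank_fin_fun] using Submodule.finrank_le V
  have h0 := det_eq_zero_of_zero_block _ _ _ hV hlt hPQ
  rw [det_map_C_mul_mul_map_C] at h0
  rcases mul_eq_zero.1 h0 with h1 | h1
  · exfalso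
    refine mul_ne_zero ?_ ?_ ((C_eq_zero).1 h1)
    · simpa [Matrix.GeneralLinearGroup.val_det_apply] using (Matrix.GeneralLinearGroup.det P).ne_zero
    · simpa [Matrix.GeneralLinearGroup.val_det_apply] using (Matrix.GeneralLinearGroup.det Q).ne_zero
  · exact h1

/-- If `0 < dim V = dim W < m` then `M` is block-decomposable. [folklore] -/
theorem isBlockDecomposable_of_subpencil {m : ℕ} (M : Matrix (Fin m) (Fin m) (MvPolynomial σ ℂ))
    (V W : Submodule ℂ (Fin m → ℂ))
    (hVW : ∀ (d : σ →₀ ℕ) (x : Fin m → ℂ), x ∈ V → Matrix.toLin' (M.map (coeff d)) x ∈ W)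
    (heq : Module.finrank ℂ V = Module.finrank ℂ W) (hpos : 0 < Module.finrank ℂ V)
    (hlt : Module.finrank ℂ V < m) : IsBlockDecomposable M := by
  obtain ⟨P, Q, hPQ⟩ := exists_block_of_subpencil M V W hVW
  exact ⟨P, Q, Module.finrank ℂ V, hpos, hlt, fun i j hi hj => hPQ i j (heq ▸ hi) hj⟩

end Block

/-! ### §4 Stable ⇒ Schurian; lifts are unique up to scalars -/

section Schurian

variable {σ : Type*}

/-- **King-stable pencils are Schurian.**  If `det M ≠ 0` and `M` admits no proper block triangularisation by constant
base changes (`¬ IsBlockDecomposable M`), then every endomorphism pair `(g, h)` of `M` — complex matrices with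
`g M = M h` — is a scalar pair `g = c · 1 = h`.  (With `λ` an eigenvalue of `g`, the kernels and the images of
`(g − λ, h − λ)` are sub-pencils; unequal dimensions would make `M` singular (Frobenius–König), equal proper ones would
decompose `M`; hence `g − λ = 0 = h − λ`.) [folklore] -/
theorem endPair_eq_smul_one_of_not_isBlockDecomposable {m : ℕ} (M : Matrix (Fin m) (Fin m) (MvPolynomial σ ℂ))
    (hM : M.det ≠ 0) (hnb : ¬ IsBlockDecomposable M) (g h : Matrix (Fin m) (Fin m) ℂ)
    (hgh : g.map C * M = M * h.map C) :
    ∃ c : ℂ, g = c • (1 : Matrix (Fin m) (Fin m) ℂ) ∧ h = c • (1 : Matrix (Fin m) (Fin m) ℂ) := by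
  classical
  rcases Nat.eq_zero_or_pos m with hm | hm
  · subst hm
    exact ⟨0, Subsingleton.elim _ _, Subsingleton.elim _ _⟩
  haveI : Nontrivial (Fin m → ℂ) := by
    haveI : Nonempty (Fin m) := ⟨⟨0, hm⟩⟩
    infer_instance
  obtain ⟨μ, hμ⟩ := Module.End.exists_eigenvalue (Matrix.toLin' g)
  -- the nilpotent-candidate pair `(g - μ, h - μ)`
  set NW : Matrix (Fin m) (Fin m) ℂ := g - μ • (1 : Matrix (Fin m) (Fin m) ℂ) with hNW
  set NV : Matrix (Fin m) (Fin m) ℂ := h - μ • (1 : Matrix (Fin m) (Fin m) ℂ) with hNV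
  have hμc : ((μ • (1 : Matrix (Fin m) (Fin m) ℂ)).map (C (σ := σ)) : Matrix (Fin m) (Fin m) (MvPolynomial σ ℂ)) * M =
      M * (μ • (1 : Matrix (Fin m) (Fin m) ℂ)).map (C (σ := σ)) := by
    have hsc : ((μ • (1 : Matrix (Fin m) (Fin m) ℂ)).map (C (σ := σ)) : Matrix (Fin m) (Fin m) (MvPolynomial σ ℂ)) =
        Matrix.diagonal (fun _ => C μ) := by
      ext i j
      by_cases hij : i = j
      · subst hij; simp
      · simp [hij]
    rw [hsc]
    ext i j
    simp [Matrix.mul_diagonal, mul_comm]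
  have hN : NW.map C * M = M * NV.map C := by
    rw [hNW, hNV]
    exact hom_sub hgh hμc
  have hNd : ∀ d : σ →₀ ℕ, NW * M.map (coeff d) = M.map (coeff d) * NV :=
    mul_map_coeff_eq_of_map_C_mul_eq M NW NV hN
  -- kernels and images are sub-pencils
  set V₁ := LinearMap.ker (Matrix.toLin' NV) with hV₁
  set W₁ := LinearMap.ker (Matrix.toLin' NW) with hW₁
  set V₂ := LinearMap.range (Matrix.toLin' NV) with hV₂
  set W₂ := LinearMap.range (Matrix.toLin' NW) with hW₂
  have hcomp : ∀ d : σ →₀ ℕ, Matrix.toLin' NW ∘ₗ Matrix.toLin' (M.map (coeff d)) =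
      Matrix.toLin' (M.map (coeff d)) ∘ₗ Matrix.toLin' NV := fun d => by
    rw [← Matrix.toLin'_mul, ← Matrix.toLin'_mul, hNd d]
  have hsub₁ : ∀ (d : σ →₀ ℕ) (x : Fin m → ℂ), x ∈ V₁ → Matrix.toLin' (M.map (coeff d)) x ∈ W₁ := by
    intro d x hx
    rw [hW₁, LinearMap.mem_ker, ← LinearMap.comp_apply, hcomp d, LinearMap.comp_apply]
    rw [hV₁, LinearMap.mem_ker] at hx
    rw [hx, map_zero]
  have hsub₂ : ∀ (d : σ →₀ ℕ) (x : Fin m → ℂ), x ∈ V₂ → Matrix.toLin' (M.map (coeff d)) x ∈ W₂ := by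
    intro d x hx
    rw [hV₂, LinearMap.mem_range] at hx
    obtain ⟨y, rfl⟩ := hx
    rw [hW₂, LinearMap.mem_range]
    exact ⟨Matrix.toLin' (M.map (coeff d)) y, by rw [← LinearMap.comp_apply, hcomp d, LinearMap.comp_apply]⟩
  -- dimensions
  set a := Module.finrank ℂ V₁ with ha
  set b := Module.finrank ℂ W₁ with hb
  have haV₂ : Module.finrank ℂ V₂ + a = m := by
    rw [hV₂, ha, hV₁, LinearMap.finrank_range_add_finrank_ker, Module.finrank_fin_fun]
  have hbW₂ : Module.finrank ℂ W₂ + b = m := by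
    rw [hW₂, hb, hW₁, LinearMap.finrank_range_add_finrank_ker, Module.finrank_fin_fun]
  have hb1 : 0 < b := by
    rw [hb, hW₁, Module.finrank_pos_iff_exists_ne_zero]
    obtain ⟨x, hx, hx0⟩ := hμ.exists_hasEigenvector
    refine ⟨⟨x, ?_⟩, fun h0 => hx0 (congrArg Subtype.val h0)⟩
    rw [LinearMap.mem_ker, hNW, map_sub, map_smul, Matrix.toLin'_one, LinearMap.sub_apply, LinearMap.smul_apply,
      LinearMap.id_apply]
    rw [Module.End.mem_eigenspace_iff] at hx
    rw [hx, sub_self]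
  -- `a = b`
  have hab : a = b := by
    by_contra hne
    rcases Nat.lt_or_gt_of_ne hne with hlt | hlt
    · -- `a < b`: the image sub-pencil is too small on the target side
      have : Module.finrank ℂ W₂ < Module.finrank ℂ V₂ := by omega
      exact hM (det_eq_zero_of_subpencil M V₂ W₂ hsub₂ this)
    · exact hM (det_eq_zero_of_subpencil M V₁ W₁ hsub₁ hlt)
  -- `a = m`
  have ham : a = m := by
    by_contra hne
    have hlt : a < m := lt_of_le_of_ne (by
      have := Submodule.finrank_le V₁; simpa [Module.finrank_fin_fun] using this) hne
    exact hnb (isBlockDecomposable_of_subpencil M V₁ W₁ hsub₁ hab (by rw [← ha, hab]; exact hb1) hlt)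
  -- conclude
  have hV₁top : V₁ = ⊤ := Submodule.eq_top_of_finrank_eq (by rw [← ha, ham, Module.finrank_fin_fun])
  have hW₁top : W₁ = ⊤ := Submodule.eq_top_of_finrank_eq (by rw [← hb, ← hab, ham, Module.finrank_fin_fun])
  have hNV0 : NV = 0 := by
    have h1 : Matrix.toLin' NV = 0 := LinearMap.ker_eq_top.1 (by rw [← hV₁]; exact hV₁top)
    exact (Matrix.toLin' (R := ℂ) (n := Fin m)).map_eq_zero_iff.1 h1
  have hNW0 : NW = 0 := by
    have h1 : Matrix.toLin' NW = 0 := LinearMap.ker_eq_top.1 (by rw [← hW₁]; exact hW₁top)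
    exact (Matrix.toLin' (R := ℂ) (n := Fin m)).map_eq_zero_iff.1 h1
  refine ⟨μ, ?_, ?_⟩
  · rw [hNW] at hNW0; exact sub_eq_zero.1 hNW0
  · rw [hNV] at hNV0; exact sub_eq_zero.1 hNV0

/-- **Exact lifts of a stable pencil are unique up to scalars.**  If `det M ≠ 0`, `M` is not block-decomposable and
`G M H⁻¹ = G' M H'⁻¹` for `G, H, G', H' ∈ GL_m(ℂ)`, then `G = c · G'` and `H = c · H'` for one scalar `c`.
[folklore] -/
theorem lift_eq_smul_of_not_isBlockDecomposable {m : ℕ} (M : Matrix (Fin m) (Fin m) (MvPolynomial σ ℂ))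
    (hM : M.det ≠ 0) (hnb : ¬ IsBlockDecomposable M) (G H G' H' : GL (Fin m) ℂ)
    (hlift : (G : Matrix (Fin m) (Fin m) ℂ).map C * M * ((H⁻¹ : GL (Fin m) ℂ) : Matrix (Fin m) (Fin m) ℂ).map C =
      (G' : Matrix (Fin m) (Fin m) ℂ).map C * M * ((H'⁻¹ : GL (Fin m) ℂ) : Matrix (Fin m) (Fin m) ℂ).map C) :
    ∃ c : ℂ, (G : Matrix (Fin m) (Fin m) ℂ) = c • (G' : Matrix (Fin m) (Fin m) ℂ) ∧
      (H : Matrix (Fin m) (Fin m) ℂ) = c • (H' : Matrix (Fin m) (Fin m) ℂ) := by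
  set g : Matrix (Fin m) (Fin m) ℂ := ((G'⁻¹ * G : GL (Fin m) ℂ) : Matrix (Fin m) (Fin m) ℂ) with hg
  set h : Matrix (Fin m) (Fin m) ℂ := ((H'⁻¹ * H : GL (Fin m) ℂ) : Matrix (Fin m) (Fin m) ℂ) with hh
  have hgh : g.map C * M = M * h.map C := by
    -- multiply `hlift` by `G'⁻¹` on the left and by `H` on the right
    have h1 := congrArg (fun X => ((G'⁻¹ : GL (Fin m) ℂ) : Matrix (Fin m) (Fin m) ℂ).map C * X *
      ((H : GL (Fin m) ℂ) : Matrix (Fin m) (Fin m) ℂ).map C) hlift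
    rw [hg, hh, Units.val_mul, Units.val_mul, Matrix.map_mul, Matrix.map_mul]
    have eL : ((G'⁻¹ : GL (Fin m) ℂ) : Matrix (Fin m) (Fin m) ℂ).map C *
        ((G : Matrix (Fin m) (Fin m) ℂ).map C * M * ((H⁻¹ : GL (Fin m) ℂ) : Matrix (Fin m) (Fin m) ℂ).map C) *
        ((H : GL (Fin m) ℂ) : Matrix (Fin m) (Fin m) ℂ).map C =
        ((G'⁻¹ : GL (Fin m) ℂ) : Matrix (Fin m) (Fin m) ℂ).map C * (G : Matrix (Fin m) (Fin m) ℂ).map C * M := by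
      rw [Matrix.mul_assoc, Matrix.mul_assoc, Matrix.mul_assoc, ← Matrix.map_mul, ← Units.val_mul, inv_mul_cancel,
        Units.val_one, Matrix.map_one C C_0 C_1, Matrix.mul_one, Matrix.mul_assoc]
    have eR : ((G'⁻¹ : GL (Fin m) ℂ) : Matrix (Fin m) (Fin m) ℂ).map C *
        ((G' : Matrix (Fin m) (Fin m) ℂ).map C * M * ((H'⁻¹ : GL (Fin m) ℂ) : Matrix (Fin m) (Fin m) ℂ).map C) *
        ((H : GL (Fin m) ℂ) : Matrix (Fin m) (Fin m) ℂ).map C =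
        M * (((H'⁻¹ : GL (Fin m) ℂ) : Matrix (Fin m) (Fin m) ℂ).map C * (H : Matrix (Fin m) (Fin m) ℂ).map C) := by
      rw [← Matrix.mul_assoc, ← Matrix.mul_assoc, ← Matrix.map_mul, ← Units.val_mul, inv_mul_cancel, Units.val_one,
        Matrix.map_one C C_0 C_1, Matrix.one_mul, Matrix.mul_assoc]
    rw [eL, eR] at h1
    exact h1
  obtain ⟨c, hgc, hhc⟩ := endPair_eq_smul_one_of_not_isBlockDecomposable M hM hnb g h hgh
  refine ⟨c, ?_, ?_⟩
  · have h1 : (G : Matrix (Fin m) (Fin m) ℂ) = (G' : Matrix (Fin m) (Fin m) ℂ) * g := by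
      rw [hg, Units.val_mul, ← Matrix.mul_assoc, ← Units.val_mul, mul_inv_cancel, Units.val_one, Matrix.one_mul]
    rw [h1, hgc, Matrix.mul_smul, Matrix.mul_one]
  · have h1 : (H : Matrix (Fin m) (Fin m) ℂ) = (H' : Matrix (Fin m) (Fin m) ℂ) * h := by
      rw [hh, Units.val_mul, ← Matrix.mul_assoc, ← Units.val_mul, mul_inv_cancel, Units.val_one, Matrix.one_mul]
    rw [h1, hhc, Matrix.mul_smul, Matrix.mul_one]

/-- **Lifts of commuting substitutions commute up to a root of unity.**  If `det M ≠ 0`, `M` is not block-decomposable,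
`(G, H)` lifts `γ` and `(G', H')` lifts `γ'` exactly (`M(γ·x) = G M H⁻¹`, `M(γ'·x) = G' M H'⁻¹`) and `γ γ' = γ' γ`, then
`G G' = c · G' G` and `H H' = c · H' H` with `c ^ m = 1`: the lifts form a projective representation with commutator
values in `μ_m`. [folklore] -/
theorem lift_comm_up_to_scalar {m : ℕ} [Fintype σ] [DecidableEq σ] (M : Matrix (Fin m) (Fin m) (MvPolynomial σ ℂ))
    (hM : M.det ≠ 0) (hnb : ¬ IsBlockDecomposable M) (γ γ' : GL σ ℂ) (hcomm : γ * γ' = γ' * γ)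
    (G H G' H' : GL (Fin m) ℂ)
    (hG : Matrix.linSubstEntries γ M =
      (G : Matrix (Fin m) (Fin m) ℂ).map C * M * ((H⁻¹ : GL (Fin m) ℂ) : Matrix (Fin m) (Fin m) ℂ).map C)
    (hG' : Matrix.linSubstEntries γ' M =
      (G' : Matrix (Fin m) (Fin m) ℂ).map C * M * ((H'⁻¹ : GL (Fin m) ℂ) : Matrix (Fin m) (Fin m) ℂ).map C) :
    ∃ c : ℂ, c ^ m = 1 ∧
      ((G * G' : GL (Fin m) ℂ) : Matrix (Fin m) (Fin m) ℂ) = c • ((G' * G : GL (Fin m) ℂ) : Matrix (Fin m) (Fin m) ℂ) ∧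
      ((H * H' : GL (Fin m) ℂ) : Matrix (Fin m) (Fin m) ℂ) = c • ((H' * H : GL (Fin m) ℂ) : Matrix (Fin m) (Fin m) ℂ) := by
  -- both `(G'G, H'H)` and `(GG', HH')` lift `γ' γ = γ γ'`
  have hlift2 : ∀ (δ δ' : GL σ ℂ) (A B A' B' : GL (Fin m) ℂ),
      Matrix.linSubstEntries δ M =
        (A : Matrix (Fin m) (Fin m) ℂ).map C * M * ((B⁻¹ : GL (Fin m) ℂ) : Matrix (Fin m) (Fin m) ℂ).map C →
      Matrix.linSubstEntries δ' M =
        (A' : Matrix (Fin m) (Fin m) ℂ).map C * M * ((B'⁻¹ : GL (Fin m) ℂ) : Matrix (Fin m) (Fin m) ℂ).map C →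
      Matrix.linSubstEntries (δ' * δ) M =
        ((A * A' : GL (Fin m) ℂ) : Matrix (Fin m) (Fin m) ℂ).map C * M *
          (((B * B')⁻¹ : GL (Fin m) ℂ) : Matrix (Fin m) (Fin m) ℂ).map C := by
    intro δ δ' A B A' B' hA hA'
    rw [← Matrix.linSubstEntries_linSubstEntries, hA, Matrix.linSubstEntries_mul, Matrix.linSubstEntries_mul,
      Matrix.linSubstEntries_map_C, Matrix.linSubstEntries_map_C, hA', _root_.mul_inv_rev, Units.val_mul, Units.val_mul,
      Matrix.map_mul, Matrix.map_mul]
    simp only [Matrix.mul_assoc]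
  have h1 := hlift2 γ γ' G H G' H' hG hG'
  have h2 := hlift2 γ' γ G' H' G H hG' hG
  rw [hcomm, h1] at h2
  obtain ⟨c, hcG, hcH⟩ := lift_eq_smul_of_not_isBlockDecomposable M hM hnb (G * G') (H * H') (G' * G) (H' * H) h2
  refine ⟨c, ?_, hcG, hcH⟩
  -- determinants: `det (GG') = c^m det (G'G)` and `det (G'G) = det (GG') ≠ 0`
  have hdet := congrArg Matrix.det hcG
  rw [Matrix.det_smul, Fintype.card_fin, Units.val_mul, Units.val_mul, Matrix.det_mul, Matrix.det_mul,
    mul_comm (Matrix.det (G' : Matrix (Fin m) (Fin m) ℂ))] at hdet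
  have hne : (G : Matrix (Fin m) (Fin m) ℂ).det * (G' : Matrix (Fin m) (Fin m) ℂ).det ≠ 0 := by
    refine mul_ne_zero ?_ ?_
    · simpa [Matrix.GeneralLinearGroup.val_det_apply] using (Matrix.GeneralLinearGroup.det G).ne_zero
    · simpa [Matrix.GeneralLinearGroup.val_det_apply] using (Matrix.GeneralLinearGroup.det G').ne_zero
  have h3 : (1 : ℂ) * ((G : Matrix (Fin m) (Fin m) ℂ).det * (G' : Matrix (Fin m) (Fin m) ℂ).det) =
      c ^ m * ((G : Matrix (Fin m) (Fin m) ℂ).det * (G' : Matrix (Fin m) (Fin m) ℂ).det) := by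
    rw [one_mul]; exact hdet
  exact (mul_right_cancel₀ hne h3).symm

end Schurian

end Summit.ValiantsHypothesis.ValiantsHypothesis.Theorems.FreeSubtorusOrbitDimensionBound.SquareCovering
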